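import Summits.MatrixMultiplication.MatrixMultiplication.Theorems.AbelianSTPPCensusShapeCertVQDefsS

/-!
# Abelian STPP census — kernel evaluation of the vQ certificate `checkQS` at order 461, path segments (part a)

Cell mm-stpp, rung F-M1; successor kernel item VQ-CERT (T_E beyond 417 under vQ := vP ∧ E3⁺) in support of the closed crux item
stmt-MatrixMultiplication-19191; seat mm-stpp-vp-p2 (gen 2); support file (no definitions).  PATH SEGMENTS of `ShapeCertVQ.checkQS 461`
(`…ShapeCertVQDefsS`): `pathOutS 461 path i n` = at the node reached by `path` (pairs (block, member), last step first; `[]` = root)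
the node-level decision, else the walk of the pool's blocks `i … i+n−1`; `pathInS 461 path i j n` = the walk of the members
`j … j+n−1` of block `i`; each by `decide +kernel` (no `native_decide`, standard axioms, `Elab.async false`), sized by the seat's
planner (`work/Plan.lean`: ≤ 45 000 cost units ≈ 45 s of kernel work per declaration).  Assembled into `checkQS 461 = true` in
`…AbelianSTPPCensusShapeCertVQEvalS461` by the lemmas of `…ShapeCertVQSearchPS`.
WHAT THIS IS NOT: Boolean evaluations; no statement about STPP families or `ω` by themselves.
-/

set_option linter.dupNamespace false -- `MatrixMultiplication.MatrixMultiplication` (summit = problem, D-0017)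
set_option autoImplicit false
set_option Elab.async false -- sequential kernel evaluations

namespace Summit.MatrixMultiplication.MatrixMultiplication.Theorems.ShapeCertVQ

set_option maxHeartbeats 0 in
/-- path segment of `checkQS 461` (planner cost ≈ 2086; kernel evaluation) -/
theorem pso_461_r_o0_5 : pathOutS 461 [] 0 5 = true := by
  decide +kernel

set_option maxHeartbeats 0 in
/-- path segment of `checkQS 461` (planner cost ≈ 40; kernel evaluation) -/
theorem psi_461_r_b5_0_5 : pathInS 461 [] 5 0 5 = true := by
  decide +kernel

set_option maxHeartbeats 0 in
/-- path segment of `checkQS 461` (planner cost ≈ 82507; kernel evaluation) -/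
theorem psi_461_r_5x5_b0_0_19 : pathInS 461 [(5, 5)] 0 0 19 = true := by
  decide +kernel

set_option maxHeartbeats 0 in
/-- path segment of `checkQS 461` (planner cost ≈ 78543; kernel evaluation) -/
theorem psi_461_r_5x5_b0_19_9999 : pathInS 461 [(5, 5)] 0 19 9999 = true := by
  decide +kernel

set_option maxHeartbeats 0 in
/-- path segment of `checkQS 461` (planner cost ≈ 22600; kernel evaluation) -/
theorem pso_461_r_5x5_o1_9999 : pathOutS 461 [(5, 5)] 1 9999 = true := by
  decide +kernel

end Summit.MatrixMultiplication.MatrixMultiplication.Theorems.ShapeCertVQ
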